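import Summits.ValiantsHypothesis.ValiantsHypothesis.Theorems.LacunarySymmetroidMatrixDescartesPivotRankOneFourKillSeven

/-!
# `MatrixDescartes` census — the `(2,4)₁` cell with RANK-ONE letters: the bottom-block condition (T) for `Z₊ ≤ 8`
# (fourth kept four-set of the kill-seven argument: the pivot square with the two letters below the pivot)

HONEST FRAMING.  Object-search cell `pub-symmetroid`, seat `val-sym-mdr-p1` (generation 12); helper file `--supports` the crux item
stmt-ValiantsHypothesis-18050 (`Theses.LacunarySymmetroid.MatrixDescartes`, OPEN, on HOLD) with NO closure claim.  Companion of
`…PivotRankOneFourKillSeven` ((S)), `…KillSevenPrime` ((S′)), `…KillSevenPairs` ((P)); engine `…PivotTwoDirectionsBlockLaw`.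

**THEOREM (`rankOne_posRoots_le_eight_of_condT`, real-parameter form `elevenNomial_condT_le_eight`).**  For the rank-one pencil
`F = X^e J + ∑ₖ wₖ X^{dₖ} vₖvₖᵀ` (`d₀ < d₁ < e < d₂ < d₃`, `w₀, w₁ > 0`, `det J < 0`, letter `0` pairing negatively with `J`) with the
chamber-(B) gap conditions `d₀ + d₂ < e + d₁`, `d₁ + d₂ < 2e`, `2e < d₀ + d₃`, the condition (T)
`m(J,v₀)·m(J,v₁)·Π(e+d₀)·Π(e+d₁) ≤ Δ₀₁²·|det J|·Π(d₀+d₁)·Π(2e)` (distance products to the seven killed degrees `e+d₂, e+d₃, d₀+d₂,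
d₀+d₃, d₁+d₂, d₁+d₃, d₂+d₃`, spelled out) gives `Z₊ ≤ 8`: the survivors `d₀+d₁ < e+d₀ < e+d₁ < 2e` (two translated pairs, shift
`e − d₁`) form minus `A X^{d₀+d₁} − B X^{e+d₀} + C X^{e+d₁} − D X^{2e}` with `B, D > 0`, and (T) is the cross-ratio hypothesis.  If
letter `1` is NOT core (`m(J,v₁) ≥ 0`) the condition holds trivially — consistent with the tree's off-cell law.

LOCATED, NOT CLAIMED (exp/cover24.py): in 300 000 chamber-(B) samples (letters up to `10⁻⁷` from the core boundary, near-parallel pairs,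
both at once) the three kernel conditions (S), (S′), (P) left 341 samples (0.11 %, all triply degenerate: letter `0` and letters `2, 3` at
the boundary with `2 ∥ 3`), and (T) held in ALL of them — (S) ∨ (S′) ∨ (P) ∨ (T) had NO located exception in chamber (B).  The covering
lemma is not proved; the rank-one law `(2,4)₁ ≤ 8` is NOT claimed.  Nothing here bears on `MatrixDescartes` in its window, on
`DoorA26` / `DoorA34`, registers / credences, or `VP ≠ VNP`.

[folklore] As in the companions.  No definitions, no named facts.
-/

-- `Summit.ValiantsHypothesis.ValiantsHypothesis.…` repeats a component by the D-0017 layout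
-- (single-conjunct summit), which the `dupNamespace` linter flags; the name is mandated.
set_option linter.dupNamespace false

namespace Summit.ValiantsHypothesis.ValiantsHypothesis.Theorems.LacunarySymmetroidMatrixDescartes.Pivot.TwoDirections.BlockLaw

open Polynomial Matrix Finset
open scoped BigOperators

/-- **The eleven-nomial under the chamber-(B) gap conditions and the bottom-block condition (T) has at most eight positive roots** (kept set
`{d₀+d₁, e+d₀, e+d₁, 2e}` = the pivot with the two letters below it; killed: the seven degrees involving `d₂, d₃`; `w₀, w₁ > 0`,
`m₀ < 0`, `dJ < 0`; (T): `m₀·m₁·Π(e+d₀)·Π(e+d₁) ≤ D01·|dJ|·Π(d₀+d₁)·Π(2e)`). -/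
theorem elevenNomial_condT_le_eight (e d₀ d₁ d₂ d₃ : ℕ) (h01 : d₀ < d₁) (h1e : d₁ < e) (he2 : e < d₂) (h23 : d₂ < d₃)
    (hB1 : d₀ + d₂ < e + d₁) (hB2 : d₁ + d₂ < 2 * e) (hB3 : 2 * e < d₀ + d₃)
    (dJ m₀ m₁ m₂ m₃ w₀ w₁ w₂ w₃ D01 D02 D03 D12 D13 D23 : ℝ) (hw₀ : 0 < w₀) (hw₁ : 0 < w₁)
    (hm₀ : m₀ < 0) (hdJ : dJ < 0)
    (hS : m₀ * m₁
        * (((d₂ : ℝ) - d₀) * ((d₃ : ℝ) - d₀) * ((d₂ : ℝ) - e) * ((d₃ : ℝ) - e) * ((d₁ : ℝ) + d₂ - e - d₀) * ((d₁ : ℝ) + d₃ - e - d₀) * ((d₂ : ℝ) + d₃ - e - d₀))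
        * (((e : ℝ) + d₁ - d₀ - d₂) * ((d₂ : ℝ) - d₁) * ((d₃ : ℝ) - d₁) * ((d₀ : ℝ) + d₃ - e - d₁) * ((d₂ : ℝ) - e) * ((d₃ : ℝ) - e) * ((d₂ : ℝ) + d₃ - e - d₁))
        ≤ D01 * (-dJ)
        * (((e : ℝ) + d₂ - d₀ - d₁) * ((e : ℝ) + d₃ - d₀ - d₁) * ((d₂ : ℝ) - d₁) * ((d₃ : ℝ) - d₁) * ((d₂ : ℝ) - d₀) * ((d₃ : ℝ) - d₀) * ((d₂ : ℝ) + d₃ - d₀ - d₁))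
        * (((2 : ℝ) * e - d₀ - d₂) * ((2 : ℝ) * e - d₁ - d₂) * ((d₂ : ℝ) - e) * ((d₃ : ℝ) - e) * ((d₀ : ℝ) + d₃ - 2 * e) * ((d₁ : ℝ) + d₃ - 2 * e) * ((d₂ : ℝ) + d₃ - 2 * e))) :
    ((∑ i : Fin 11, Polynomial.C ((![dJ, w₀ * m₀, w₁ * m₁, w₂ * m₂, w₃ * m₃, w₀ * w₁ * D01, w₀ * w₂ * D02, w₀ * w₃ * D03, w₁ * w₂ * D12, w₁ * w₃ * D13, w₂ * w₃ * D23] : Fin 11 → ℝ) i) * X ^ ((![2 * e, e + d₀, e + d₁, e + d₂, e + d₃, d₀ + d₁, d₀ + d₂, d₀ + d₃, d₁ + d₂, d₁ + d₃, d₂ + d₃] : Fin 11 → ℕ) i)).roots.toFinset.filter (fun t => 0 < t)).card ≤ 8 := by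
  classical
  have h01' : (d₀ : ℝ) < d₁ := by exact_mod_cast h01
  have h1e' : (d₁ : ℝ) < e := by exact_mod_cast h1e
  have he2' : (e : ℝ) < d₂ := by exact_mod_cast he2
  have h23' : (d₂ : ℝ) < d₃ := by exact_mod_cast h23
  have hB1' : (d₀ : ℝ) + d₂ < e + d₁ := by exact_mod_cast hB1
  have hB2' : (d₁ : ℝ) + d₂ < 2 * e := by exact_mod_cast hB2
  have hB3' : 2 * (e : ℝ) < d₀ + d₃ := by exact_mod_cast hB3
  -- the four distance products (positive atoms)
  obtain ⟨PA, hPA⟩ : ∃ x : ℝ, x = ((e : ℝ) + d₂ - d₀ - d₁) * ((e : ℝ) + d₃ - d₀ - d₁) * ((d₂ : ℝ) - d₁) * ((d₃ : ℝ) - d₁) * ((d₂ : ℝ) - d₀) * ((d₃ : ℝ) - d₀) * ((d₂ : ℝ) + d₃ - d₀ - d₁) := ⟨_, rfl⟩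
  obtain ⟨PB, hPB⟩ : ∃ x : ℝ, x = ((d₂ : ℝ) - d₀) * ((d₃ : ℝ) - d₀) * ((d₂ : ℝ) - e) * ((d₃ : ℝ) - e) * ((d₁ : ℝ) + d₂ - e - d₀) * ((d₁ : ℝ) + d₃ - e - d₀) * ((d₂ : ℝ) + d₃ - e - d₀) := ⟨_, rfl⟩
  obtain ⟨PC, hPC⟩ : ∃ x : ℝ, x = ((e : ℝ) + d₁ - d₀ - d₂) * ((d₂ : ℝ) - d₁) * ((d₃ : ℝ) - d₁) * ((d₀ : ℝ) + d₃ - e - d₁) * ((d₂ : ℝ) - e) * ((d₃ : ℝ) - e) * ((d₂ : ℝ) + d₃ - e - d₁) := ⟨_, rfl⟩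
  obtain ⟨PD, hPD⟩ : ∃ x : ℝ, x = ((2 : ℝ) * e - d₀ - d₂) * ((2 : ℝ) * e - d₁ - d₂) * ((d₂ : ℝ) - e) * ((d₃ : ℝ) - e) * ((d₀ : ℝ) + d₃ - 2 * e) * ((d₁ : ℝ) + d₃ - 2 * e) * ((d₂ : ℝ) + d₃ - 2 * e) := ⟨_, rfl⟩
  have hS' : m₀ * m₁ * PB * PC ≤ D01 * (-dJ) * PA * PD := by rw [hPA, hPB, hPC, hPD]; exact hS
  clear hS
  have hPBp : 0 < PB := by
    rw [hPB]
    have f1 : 0 < (d₂ : ℝ) - d₀ := by linarith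
    have f2 : 0 < (d₃ : ℝ) - d₀ := by linarith
    have f3 : 0 < (d₂ : ℝ) - e := by linarith
    have f4 : 0 < (d₃ : ℝ) - e := by linarith
    have f5 : 0 < (d₁ : ℝ) + d₂ - e - d₀ := by linarith
    have f6 : 0 < (d₁ : ℝ) + d₃ - e - d₀ := by linarith
    have f7 : 0 < (d₂ : ℝ) + d₃ - e - d₀ := by linarith
    exact mul_pos (mul_pos (mul_pos (mul_pos (mul_pos (mul_pos f1 f2) f3) f4) f5) f6) f7
  have hPDp : 0 < PD := by
    rw [hPD]
    have f1 : 0 < (2 : ℝ) * e - d₀ - d₂ := by linarith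
    have f2 : 0 < (2 : ℝ) * e - d₁ - d₂ := by linarith
    have f3 : 0 < (d₂ : ℝ) - e := by linarith
    have f4 : 0 < (d₃ : ℝ) - e := by linarith
    have f5 : 0 < (d₀ : ℝ) + d₃ - 2 * e := by linarith
    have f6 : 0 < (d₁ : ℝ) + d₃ - 2 * e := by linarith
    have f7 : 0 < (d₂ : ℝ) + d₃ - 2 * e := by linarith
    exact mul_pos (mul_pos (mul_pos (mul_pos (mul_pos (mul_pos f1 f2) f3) f4) f5) f6) f7
  -- the four surviving coefficients
  obtain ⟨A, hA⟩ : ∃ x : ℝ, x = w₀ * w₁ * D01 * PA := ⟨_, rfl⟩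
  obtain ⟨B, hB⟩ : ∃ x : ℝ, x = w₀ * (-m₀) * PB := ⟨_, rfl⟩
  obtain ⟨C, hC⟩ : ∃ x : ℝ, x = w₁ * (-m₁) * PC := ⟨_, rfl⟩
  obtain ⟨D, hD⟩ : ∃ x : ℝ, x = (-dJ) * PD := ⟨_, rfl⟩
  have hBp : 0 < B := by rw [hB]; exact mul_pos (mul_pos hw₀ (by linarith)) hPBp
  have hDp : 0 < D := by rw [hD]; exact mul_pos (by linarith) hPDp
  have hBC : B * C ≤ A * D := by
    have e1 : B * C = (w₀ * w₁) * (m₀ * m₁ * PB * PC) := by rw [hB, hC]; ring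
    have e2 : A * D = (w₀ * w₁) * (D01 * (-dJ) * PA * PD) := by rw [hA, hD]; ring
    rw [e1, e2]
    exact mul_le_mul_of_nonneg_left hS' (mul_pos hw₀ hw₁).le
  -- seven kills
  have hkills := card_posRoots_le_kills (Finset.univ : Finset (Fin 11)) (![2 * e, e + d₀, e + d₁, e + d₂, e + d₃, d₀ + d₁, d₀ + d₂, d₀ + d₃, d₁ + d₂, d₁ + d₃, d₂ + d₃] : Fin 11 → ℕ) [e + d₂, e + d₃, d₀ + d₂, d₀ + d₃, d₁ + d₂, d₁ + d₃, d₂ + d₃] (![dJ, w₀ * m₀, w₁ * m₁, w₂ * m₂, w₃ * m₃, w₀ * w₁ * D01, w₀ * w₂ * D02, w₀ * w₃ * D03, w₁ * w₂ * D12, w₁ * w₃ * D13, w₂ * w₃ * D23] : Fin 11 → ℝ)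
  -- the killed eleven-nomial is MINUS the four-nomial `A X^{d₀+d₁} − B X^{e+d₁} + C X^{d₀+d₃} − D X^{e+d₃}`
  have hfour : (∑ i ∈ (Finset.univ : Finset (Fin 11)), Polynomial.C ((![dJ, w₀ * m₀, w₁ * m₁, w₂ * m₂, w₃ * m₃, w₀ * w₁ * D01, w₀ * w₂ * D02, w₀ * w₃ * D03, w₁ * w₂ * D12, w₁ * w₃ * D13, w₂ * w₃ * D23] : Fin 11 → ℝ) i
          * (([e + d₂, e + d₃, d₀ + d₂, d₀ + d₃, d₁ + d₂, d₁ + d₃, d₂ + d₃]).map (fun ρ : ℕ => ((((![2 * e, e + d₀, e + d₁, e + d₂, e + d₃, d₀ + d₁, d₀ + d₂, d₀ + d₃, d₁ + d₂, d₁ + d₃, d₂ + d₃] : Fin 11 → ℕ) i : ℕ) : ℝ) - (ρ : ℝ)))).prod) * X ^ ((![2 * e, e + d₀, e + d₁, e + d₂, e + d₃, d₀ + d₁, d₀ + d₂, d₀ + d₃, d₁ + d₂, d₁ + d₃, d₂ + d₃] : Fin 11 → ℕ) i))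
      = -(Polynomial.C A * X ^ (d₀ + d₁) - Polynomial.C B * X ^ (d₀ + d₁ + (e - d₁))
          + Polynomial.C C * X ^ (d₀ + d₁ + (e - d₀)) - Polynomial.C D * X ^ (d₀ + d₁ + (e - d₁) + (e - d₀))) := by
    have e3 : d₀ + d₁ + (e - d₁) + (e - d₀) = 2 * e := by omega
    have e1 : d₀ + d₁ + (e - d₁) = e + d₀ := by omega
    have e2 : d₀ + d₁ + (e - d₀) = e + d₁ := by omega
    rw [e3, e1, e2]
    have hcoef : ∀ i : Fin 11, (![dJ, w₀ * m₀, w₁ * m₁, w₂ * m₂, w₃ * m₃, w₀ * w₁ * D01, w₀ * w₂ * D02, w₀ * w₃ * D03, w₁ * w₂ * D12, w₁ * w₃ * D13, w₂ * w₃ * D23] : Fin 11 → ℝ) i * (([e + d₂, e + d₃, d₀ + d₂, d₀ + d₃, d₁ + d₂, d₁ + d₃, d₂ + d₃]).map (fun ρ : ℕ => ((((![2 * e, e + d₀, e + d₁, e + d₂, e + d₃, d₀ + d₁, d₀ + d₂, d₀ + d₃, d₁ + d₂, d₁ + d₃, d₂ + d₃] : Fin 11 → ℕ) i : ℕ) :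 ℝ) - (ρ : ℝ)))).prod
        = (![D, B, -C, 0, 0, -A, 0, 0, 0, 0, 0] : Fin 11 → ℝ) i := by
      intro i
      fin_cases i <;>
        simp only [Fin.zero_eta, Fin.mk_one, Fin.isValue, Matrix.cons_val_zero, Matrix.cons_val_one,
          List.map_cons, List.map_nil, List.prod_cons, List.prod_nil, hA, hB, hC, hD, hPA, hPB, hPC, hPD] <;>
        push_cast <;> ring
    rw [Finset.sum_congr rfl (fun i _ => by rw [hcoef i])]
    simp only [Fin.sum_univ_succ, Fin.sum_univ_zero, Matrix.cons_val_zero, Matrix.cons_val_succ, map_zero, zero_mul,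
      zero_add, add_zero, Polynomial.C_neg]
    ring
  rw [hfour, Polynomial.roots_neg] at hkills
  have hone := card_posRoots_fourNomial_le_one A B C D hBp hDp hBC (d₀ + d₁) (e - d₁) (e - d₀) (by omega)
  simp only [List.length_cons, List.length_nil] at hkills
  omega

/-- **RANK-ONE `(2,4)₁` IN CHAMBER (B): `Z₊ ≤ 8` under the bottom-block condition (T)** (matrix form; `det J < 0`, letter `0` pairing
negatively with `J`, `w₀, w₁ > 0`; (T) holds as soon as letters `0, 1` are far from parallel relative to their corenesses). [this file] -/
theorem rankOne_posRoots_le_eight_of_condT (e d₀ d₁ d₂ d₃ : ℕ) (h01 : d₀ < d₁) (h1e : d₁ < e) (he2 : e < d₂) (h23 : d₂ < d₃)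
    (hB1 : d₀ + d₂ < e + d₁) (hB2 : d₁ + d₂ < 2 * e) (hB3 : 2 * e < d₀ + d₃)
    (J : Matrix (Fin 2) (Fin 2) ℝ) (v₀ v₁ v₂ v₃ : Fin 2 → ℝ) (w₀ w₁ w₂ w₃ : ℝ) (hw₀ : 0 < w₀) (hw₁ : 0 < w₁)
    (hm₀ : (J 0 0 * v₀ 1 ^ 2 + J 1 1 * v₀ 0 ^ 2 - (J 0 1 + J 1 0) * (v₀ 0 * v₀ 1)) < 0) (hJ : J.det < 0)
    (hS : (J 0 0 * v₀ 1 ^ 2 + J 1 1 * v₀ 0 ^ 2 - (J 0 1 + J 1 0) * (v₀ 0 * v₀ 1)) * (J 0 0 * v₁ 1 ^ 2 + J 1 1 * v₁ 0 ^ 2 - (J 0 1 + J 1 0) * (v₁ 0 * v₁ 1))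
        * (((d₂ : ℝ) - d₀) * ((d₃ : ℝ) - d₀) * ((d₂ : ℝ) - e) * ((d₃ : ℝ) - e) * ((d₁ : ℝ) + d₂ - e - d₀) * ((d₁ : ℝ) + d₃ - e - d₀) * ((d₂ : ℝ) + d₃ - e - d₀))
        * (((e : ℝ) + d₁ - d₀ - d₂) * ((d₂ : ℝ) - d₁) * ((d₃ : ℝ) - d₁) * ((d₀ : ℝ) + d₃ - e - d₁) * ((d₂ : ℝ) - e) * ((d₃ : ℝ) - e) * ((d₂ : ℝ) + d₃ - e - d₁))
        ≤ ((v₀ 0 * v₁ 1 - v₀ 1 * v₁ 0) ^ 2) * (-J.det)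
        * (((e : ℝ) + d₂ - d₀ - d₁) * ((e : ℝ) + d₃ - d₀ - d₁) * ((d₂ : ℝ) - d₁) * ((d₃ : ℝ) - d₁) * ((d₂ : ℝ) - d₀) * ((d₃ : ℝ) - d₀) * ((d₂ : ℝ) + d₃ - d₀ - d₁))
        * (((2 : ℝ) * e - d₀ - d₂) * ((2 : ℝ) * e - d₁ - d₂) * ((d₂ : ℝ) - e) * ((d₃ : ℝ) - e) * ((d₀ : ℝ) + d₃ - 2 * e) * ((d₁ : ℝ) + d₃ - 2 * e) * ((d₂ : ℝ) + d₃ - 2 * e))) :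
    ((Matrix.det (((X : ℝ[X]) ^ e) • J.map Polynomial.C
        + (Polynomial.C w₀ * X ^ d₀) • (vecMulVec v₀ v₀).map Polynomial.C
        + (Polynomial.C w₁ * X ^ d₁) • (vecMulVec v₁ v₁).map Polynomial.C
        + (Polynomial.C w₂ * X ^ d₂) • (vecMulVec v₂ v₂).map Polynomial.C
        + (Polynomial.C w₃ * X ^ d₃) • (vecMulVec v₃ v₃).map Polynomial.C)).roots.toFinset.filter (fun t => 0 < t)).card
      ≤ 8 := by
  rw [det_rankOne_four_sum]
  exact elevenNomial_condT_le_eight e d₀ d₁ d₂ d₃ h01 h1e he2 h23 hB1 hB2 hB3 J.det _ _ _ _ w₀ w₁ w₂ w₃ _ _ _ _ _ _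
    hw₀ hw₁ hm₀ hJ hS

end Summit.ValiantsHypothesis.ValiantsHypothesis.Theorems.LacunarySymmetroidMatrixDescartes.Pivot.TwoDirections.BlockLaw
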